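import Summits.HubbardSuperconductivity.HubbardSuperconductivity.Theses.LiebTwin
import Summits.HubbardSuperconductivity.HubbardSuperconductivity.Theorems.LiebTwinNoOnsiteODLROEtaVacuum
import Summits.HubbardSuperconductivity.HubbardSuperconductivity.Theorems.EnslavedA1gPairChemicalPotentialWindow
import Literature.MathematicalPhysics.QuantumLattice.FreeFermionSectorEnergyDeviation

/-!
# Crux `NoOnsiteODLRO` (stmt-HubbardSuperconductivity-0933; routes `LiebTwin`, `EnslavedA1g`) —
# negative-side support for the picked line `registered` (`Cruxes/NoOnsiteODLRO/Lines/birth.lean`):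
# the kernel obstruction inside the open stub `stub_shiftedInfraredBound`

The line's single open stub asks, for every admissible sector ground-state sequence `ψ_L` of
`H = hubbardTorus 2 L 1 U`, for a prefactor `C` with, eventually in even `L` and for EVERY `v` of the
pair-removed sector `(N_L - 2, S^z = 0)`,
`‖⟨v, P_s ψ_L⟩‖² ≤ C · L² · (Re⟨v, H v⟩ + (U - E(N_L,0)) ‖v‖²)`, `P_s = pairField sWave L`,
`E(N,0) = minEnergyOn H (szSector N 0)`. The bracket is the quadratic form of `K₋ = H - E(N_L,0) + U`,
nonnegative on that sector by Yang's window. This file does NOT refute the stub (that needs ground states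
at large `L`, which nobody has); it records, kernel-checked, what the `∀ v` quantifier silently asserts and
exactly when that assertion is non-vacuous — the disprover's reading of the lead's risk (a)
(`Cruxes/NoOnsiteODLRO/PICKED.md`) for provers and planners of the line:

* `shiftedForm_eq_zero_of_zeroMode`, `dotProduct_eq_zero_of_irBound_of_zeroMode` — on a zero mode `v` of
  `K₋` the right-hand side vanishes, so the bound forces `⟨v, P_s ψ_L⟩ = 0` WHATEVER the prefactor: no
  choice of `C` (or of the power of `L`) can absorb a kernel overlap.
* `etaLower_groundState_zeroMode` — zero modes exist canonically: `η φ` (`η = etaLower torusStagger`) for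
  every ground state `φ` of the upper sector `(N_L, 0)` (adjoint Yang relation `H η = η H - U η`).
* `zeroMode_eq_zero_of_strictWindow`, `closedWindow_iff_exists_zeroMode` — the kernel of `K₋` in the
  pair-removed sector is non-trivial IFF the pair window is CLOSED, `E(N_L-2,0) = E(N_L,0) - U` (then it is
  the whole ground space of that sector); on the strict branch it is `{0}` (and `η φ = 0`, tree
  `Pseudospin.etaLower_groundState_eq_zero_of_window`, p151740).
* `shiftedInfraredBound_forces_kernel_orthogonality` — along admissible sequences the stub (spelled inline,
  verbatim) implies, eventually: `P_s ψ_L ⊥ ker K₋` and `⟨η φ, P_s ψ_L⟩ = 0` for every ground state `φ` of the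
  sector of `ψ_L`.
* `shiftedInfraredBound_false_of_kernelOverlap`, `shiftedInfraredBound_false_of_etaOverlap` — the negative
  forms: a kernel overlap frequently in `L` (closed-window sides with `P_s ψ_L` not orthogonal to the lower
  ground space, e.g. momentum-mixed degenerate ground states) refutes the stub outright, while the crux
  `NoOnsiteODLRO` is insensitive to it. So the stub is STRICTLY more exposed than the crux exactly on the
  closed-window branch. Repairs: quantify `v` over `(ker K₋)ᗮ ∩ szSector (N_L-2) 0` — then the Falk–Bruch
  engine (which tests `v = P_s ψ_L`) controls only the component of `P_s ψ_L` off the kernel, and the kernel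
  component `‖Π_ker P_s ψ_L‖²` needs its own `o(L⁴)` bound (by `‖P_sᴴ g‖² = S(g) + O(L²)‖g‖²` this is the crux
  one sector down when `dim ker K₋ = O(1)`); or carry the strict window as an explicit hypothesis of the line
  (census B4 `StrictPairWindow`), under which both hidden assertions are vacuous.

Sources: C. N. Yang, PRL **63** (1989) 2144, eqs. (4)–(6); S. C. Zhang, PRL **65** (1990) 120; K. Kubo,
T. Kishi, PRB **41** (1990) 4866, Thm 2 (the bound being transplanted); H. Tasaki, *Physics and Mathematics
of Quantum Many-Body Systems* (2020) §2.1–2.2 (variational principle). Elementary given the tree's Yang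
commutator, sector ground states and `Pseudospin` lemmas; no definition is introduced (the stub is spelled
inline).
-/

noncomputable section

set_option linter.dupNamespace false

namespace Summit.HubbardSuperconductivity.HubbardSuperconductivity.Theorems.NoOnsiteODLRO.Negative

open Matrix
open Literature.Probability.LatticeModels Literature.MathematicalPhysics.QuantumLattice
open Summit.HubbardSuperconductivity.HubbardSuperconductivity.Theorems.NoOnsiteODLRO.Pseudospin
  (hubbardTorus_mul_etaLower isInSector_etaLower_mulVec)
open Summit.HubbardSuperconductivity.HubbardSuperconductivity.Theorems.EnslavedA1g
  (minEnergyOn_pairAdded_le)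
open scoped ComplexOrder

variable {L : ℕ}

/-! ### Fixed side: the shifted form vanishes on zero modes of `K₋ = H - E + U` -/

/-- On a zero mode `v` of `K₋ = H - E + U` (`H v = (E - U) v`) the `U`-shifted quadratic form
`Re⟨v, H v⟩ + (U - E) ‖v‖²` — the right-hand side of the infrared bound — vanishes. [folklore] -/
theorem shiftedForm_eq_zero_of_zeroMode (U E : ℝ) {v : Fock (Orb (FermionTorus 2 L))}
    (hv : hubbardTorus 2 L 1 U *ᵥ v = ((E - U : ℝ) : ℂ) • v) :
    (expect (hubbardTorus 2 L 1 U) v).re + (U - E) * (star v ⬝ᵥ v).re = 0 := by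
  unfold expect
  rw [hv, dotProduct_smul, smul_eq_mul, Complex.re_ofReal_mul]
  ring

/-- **Kernel orthogonality at fixed side.** If the infrared bound
`‖⟨v, w⟩‖² ≤ A · (Re⟨v, H v⟩ + (U - E) ‖v‖²)` holds at a zero mode `v` of `K₋ = H - E + U`, then
`⟨v, w⟩ = 0`: the bound forces `w ⊥ ker K₋`, whatever the prefactor `A`. [folklore] -/
theorem dotProduct_eq_zero_of_irBound_of_zeroMode {U E A : ℝ} {v w : Fock (Orb (FermionTorus 2 L))}
    (hIR : ‖star v ⬝ᵥ w‖ ^ 2 ≤ A * ((expect (hubbardTorus 2 L 1 U) v).re + (U - E) * (star v ⬝ᵥ v).re))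
    (hv : hubbardTorus 2 L 1 U *ᵥ v = ((E - U : ℝ) : ℂ) • v) : star v ⬝ᵥ w = 0 := by
  rw [shiftedForm_eq_zero_of_zeroMode U E hv, mul_zero] at hIR
  have h0 : ‖star v ⬝ᵥ w‖ ^ 2 = 0 := le_antisymm hIR (by positivity)
  exact norm_eq_zero.1 (pow_eq_zero_iff two_ne_zero |>.1 h0)

/-! ### Zero modes of `K₋`: `η` of any ground state of the upper sector -/

/-- **`η` of a sector ground state is a zero mode of `K₋` in the pair-removed sector.** For even `L`
and a ground state `φ` of `H = hubbardTorus 2 L 1 U` in the joint sector `(N, S^z = 0)`, `N ≥ 2`,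
with `E = E(N, 0)`: `η φ := etaLower torusStagger φ` lies in `szSector (N - 2) 0` and
`H (η φ) = (E - U) η φ` (adjoint Yang relation `H η = η H - U η`). Yang, PRL 63 (1989) 2144, eq. (6). [folklore] -/
theorem etaLower_groundState_zeroMode (hL : Even L) (U : ℝ) {N : ℕ} (hN : 2 ≤ N)
    {φ : Fock (Orb (FermionTorus 2 L))} (hφ : IsGroundStateInSector (hubbardTorus 2 L 1 U) N 0 φ) :
    etaLower torusStagger *ᵥ φ ∈ szSector (Λ := FermionTorus 2 L) (N - 2) 0 ∧
      hubbardTorus 2 L 1 U *ᵥ (etaLower torusStagger *ᵥ φ) =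
        (((hubbardTorus 2 L 1 U).minEnergyOn (szSector (Λ := FermionTorus 2 L) N 0) - U : ℝ) : ℂ) •
          (etaLower torusStagger *ᵥ φ) := by
  obtain ⟨hmem, hne, hHφ⟩ := hφ
  obtain ⟨n, rfl⟩ := exists_eq_two_mul_of_mem_szSector_zero hmem hne
  obtain ⟨m, rfl⟩ : ∃ m, n = m + 1 := ⟨n - 1, by omega⟩
  have h2m : 2 * (m + 1) - 2 = 2 * m := by omega
  refine ⟨?_, ?_⟩
  · rw [h2m]
    have hφsec : IsInSector (m + 1) (m + 1) φ := (mem_szSector_two_mul_zero_iff (m + 1) φ).1 hmem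
    exact (mem_szSector_two_mul_zero_iff m _).2 (isInSector_etaLower_mulVec hφsec torusStagger)
  · rw [mulVec_mulVec, hubbardTorus_mul_etaLower hL U, sub_mulVec, ← mulVec_mulVec, hHφ, mulVec_smul,
      smul_mulVec, ← sub_smul, Complex.ofReal_sub]

/-! ### When is the kernel non-trivial? Exactly on the closed-window branch -/

/-- **Strict window ⇒ trivial kernel.** If `0 < U - (E(2n+2,0) - E(2n,0))` then `K₋ = H - E(2n+2,0) + U`
has no nonzero zero mode in the pair-removed sector `(2n, 0)` (variational principle there:
`H ≥ E(2n,0) > E(2n+2,0) - U`). Tasaki (2020) §2.1. [folklore] -/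
theorem zeroMode_eq_zero_of_strictWindow (U : ℝ) {n : ℕ} (hn : 2 * n + 2 ≤ L ^ 2)
    (hw : 0 < U - ((hubbardTorus 2 L 1 U).minEnergyOn (szSector (Λ := FermionTorus 2 L) (2 * n + 2) 0) -
      (hubbardTorus 2 L 1 U).minEnergyOn (szSector (Λ := FermionTorus 2 L) (2 * n) 0)))
    {v : Fock (Orb (FermionTorus 2 L))} (hv : v ∈ szSector (Λ := FermionTorus 2 L) (2 * n) 0)
    (hHv : hubbardTorus 2 L 1 U *ᵥ v =
      (((hubbardTorus 2 L 1 U).minEnergyOn (szSector (Λ := FermionTorus 2 L) (2 * n + 2) 0) - U : ℝ) : ℂ) • v) :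
    v = 0 := by
  set H := hubbardTorus 2 L 1 U with hHdef
  set E : ℝ := H.minEnergyOn (szSector (Λ := FermionTorus 2 L) (2 * n + 2) 0) with hEdef
  set E' : ℝ := H.minEnergyOn (szSector (Λ := FermionTorus 2 L) (2 * n) 0) with hE'def
  have hcard : Fintype.card (FermionTorus 2 L) = L ^ 2 := card_fermionTorus 2 L
  have hm : n ≤ Fintype.card (FermionTorus 2 L) := by rw [hcard]; omega
  have hvsec : IsInSector n n v := (mem_szSector_two_mul_zero_iff n v).1 hv
  have hvar := (szSector_groundState (fermionTorusGraph 2 L) 1 U hm).2 v hvsec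
  change E' * (star v ⬝ᵥ v).re ≤ (star v ⬝ᵥ (H *ᵥ v)).re at hvar
  rw [hHv, dotProduct_smul, smul_eq_mul, Complex.re_ofReal_mul] at hvar
  have hnn : 0 ≤ (star v ⬝ᵥ v).re := (Complex.nonneg_iff.mp (dotProduct_star_self_nonneg _)).1
  have hzero : (star v ⬝ᵥ v).re = 0 := by nlinarith
  have hzeroC : star v ⬝ᵥ v = 0 := by
    have him : (star v ⬝ᵥ v).im = 0 := (Complex.nonneg_iff.mp (dotProduct_star_self_nonneg _)).2.symm
    exact Complex.ext hzero him
  exact (LiebThm1.star_dotProduct_self_eq_zero_iff v).1 hzeroC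

/-- **Closed window ⇔ non-trivial kernel.** For even `L`, `2n + 2 ≤ L²`: the pair window at `N = 2n+2`
is CLOSED, `E(2n,0) = E(2n+2,0) - U`, iff `K₋ = H - E(2n+2,0) + U` has a nonzero zero mode in the
pair-removed sector `(2n, 0)` (then the whole ground space of that sector is its kernel). Uses Yang's
upper bound `E(2n+2,0) ≤ E(2n,0) + U` and the existence of sector ground states.
Yang, PRL 63 (1989) 2144; Tasaki (2020) §2.2. [folklore] -/
theorem closedWindow_iff_exists_zeroMode (hL : Even L) (U : ℝ) {n : ℕ} (hn : 2 * n + 2 ≤ L ^ 2) :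
    (hubbardTorus 2 L 1 U).minEnergyOn (szSector (Λ := FermionTorus 2 L) (2 * n) 0) =
        (hubbardTorus 2 L 1 U).minEnergyOn (szSector (Λ := FermionTorus 2 L) (2 * n + 2) 0) - U ↔
      ∃ v ∈ szSector (Λ := FermionTorus 2 L) (2 * n) 0, v ≠ 0 ∧
        hubbardTorus 2 L 1 U *ᵥ v =
          (((hubbardTorus 2 L 1 U).minEnergyOn (szSector (Λ := FermionTorus 2 L) (2 * n + 2) 0) - U : ℝ) : ℂ) • v := by
  set H := hubbardTorus 2 L 1 U with hHdef
  have hcard : Fintype.card (FermionTorus 2 L) = L ^ 2 := card_fermionTorus 2 L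
  have hm : n ≤ Fintype.card (FermionTorus 2 L) := by rw [hcard]; omega
  constructor
  · intro hclosed
    obtain ⟨⟨φ, hφmem, hφne, hHφ⟩, -⟩ := szSector_groundState (fermionTorusGraph 2 L) 1 U hm
    refine ⟨φ, hφmem, hφne, ?_⟩
    change H *ᵥ φ = (((H.minEnergyOn (szSector (Λ := FermionTorus 2 L) (2 * n) 0)) : ℝ) : ℂ) • φ at hHφ
    rw [hHφ, hclosed]
  · rintro ⟨v, hv, hvne, hHv⟩
    -- Yang: `E(2n+2) ≤ E(2n) + U`; the zero mode: `E(2n) ≤ E(2n+2) - U`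
    have hup : H.minEnergyOn (szSector (Λ := FermionTorus 2 L) (2 * (n + 1)) 0) ≤
        H.minEnergyOn (szSector (Λ := FermionTorus 2 L) (2 * n) 0) + U :=
      minEnergyOn_pairAdded_le L U hL (by omega)
    have h2 : 2 * (n + 1) = 2 * n + 2 := by ring
    rw [h2] at hup
    by_contra hneq
    have hw : 0 < U - (H.minEnergyOn (szSector (Λ := FermionTorus 2 L) (2 * n + 2) 0) -
        H.minEnergyOn (szSector (Λ := FermionTorus 2 L) (2 * n) 0)) := by
      rcases lt_or_gt_of_ne hneq with hlt | hgt
      · linarith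
      · linarith
    exact hvne (zeroMode_eq_zero_of_strictWindow U hn hw hv hHv)

/-! ### Along admissible sequences: what the open stub `stub_shiftedInfraredBound` silently asserts -/

/-- The admissible filling is at least one pair as soon as `L ≥ 2` (`δ < 1/2`). [folklore] -/
theorem one_le_floor_filling {δ : ℝ} (hδ : δ < 1 / 2) (hL : 2 ≤ L) :
    1 ≤ ⌊(1 - δ) * (L : ℝ) ^ 2 / 2⌋₊ := by
  have hL' : (2 : ℝ) ≤ (L : ℝ) := by exact_mod_cast hL
  have h4 : (4 : ℝ) ≤ (L : ℝ) ^ 2 := by nlinarith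
  have h1 : (1 : ℝ) ≤ (1 - δ) * (L : ℝ) ^ 2 / 2 := by nlinarith
  exact Nat.le_floor (by exact_mod_cast h1)

/-- **HIDDEN ASSERTION of the line's open stub** (`Cruxes/NoOnsiteODLRO/Lines/birth.lean`,
`stub_shiftedInfraredBound`, quantified over ALL `v` of the pair-removed sector with the `K₋`-FORM on the
right). If the `U`-shifted infrared bound holds along an admissible ground-state sequence, then, eventually
in even `L`: (i) `P_s ψ_L = pairField sWave L ψ_L` is ORTHOGONAL to every zero mode of
`K₋ = H - E(N_L,0) + U` in the sector `(N_L - 2, 0)`; (ii) in particular `⟨η φ, P_s ψ_L⟩ = 0` for EVERY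
ground state `φ` of the same sector `(N_L, 0)` (`η = etaLower torusStagger`; `η φ` is such a zero mode,
`etaLower_groundState_zeroMode`). On the strict-window branch both are vacuous
(`zeroMode_eq_zero_of_strictWindow`, and `η φ = 0` by `Pseudospin.etaLower_groundState_eq_zero_of_window`);
on the closed-window branch (`closedWindow_iff_exists_zeroMode`) they are genuine constraints on the unknown
ground states which no prefactor `C` can absorb. Kubo–Kishi, PRB 41 (1990) 4866 (the bound transplanted);
Yang, PRL 63 (1989) 2144. [folklore] -/
theorem shiftedInfraredBound_forces_kernel_orthogonality
    (h : ∀ (U δ : ℝ), 0 < U → δ ∈ Set.Ioo (0 : ℝ) (1 / 2) →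
      ∀ (N : ℕ → ℕ) (ψ : ∀ L, Fock (Orb (FermionTorus 2 L))),
        (∀ L, Even L → N L = 2 * ⌊(1 - δ) * (L : ℝ) ^ 2 / 2⌋₊ ∧ star (ψ L) ⬝ᵥ ψ L = 1 ∧
            IsGroundStateInSector (hubbardTorus 2 L 1 U) (N L) 0 (ψ L)) →
          ∃ C : ℝ, 0 ≤ C ∧ ∃ L₀ : ℕ, ∀ (L : ℕ) [NeZero L], Even L → L₀ ≤ L →
            ∀ v : Fock (Orb (FermionTorus 2 L)), v ∈ szSector (Λ := FermionTorus 2 L) (N L - 2) 0 →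
              ‖star v ⬝ᵥ ((pairField sWave L) *ᵥ (ψ L))‖ ^ 2 ≤
                C * (L : ℝ) ^ 2 *
                  ((expect (hubbardTorus 2 L 1 U) v).re +
                    (U - (hubbardTorus 2 L 1 U).minEnergyOn (szSector (Λ := FermionTorus 2 L) (N L) 0)) *
                      (star v ⬝ᵥ v).re)) :
    ∀ (U δ : ℝ), 0 < U → δ ∈ Set.Ioo (0 : ℝ) (1 / 2) →
      ∀ (N : ℕ → ℕ) (ψ : ∀ L, Fock (Orb (FermionTorus 2 L))),
        (∀ L, Even L → N L = 2 * ⌊(1 - δ) * (L : ℝ) ^ 2 / 2⌋₊ ∧ star (ψ L) ⬝ᵥ ψ L = 1 ∧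
            IsGroundStateInSector (hubbardTorus 2 L 1 U) (N L) 0 (ψ L)) →
          ∃ L₀ : ℕ, ∀ (L : ℕ) [NeZero L], Even L → L₀ ≤ L →
            (∀ v : Fock (Orb (FermionTorus 2 L)), v ∈ szSector (Λ := FermionTorus 2 L) (N L - 2) 0 →
                hubbardTorus 2 L 1 U *ᵥ v =
                  (((hubbardTorus 2 L 1 U).minEnergyOn (szSector (Λ := FermionTorus 2 L) (N L) 0) - U : ℝ) : ℂ) •
                    v →
                  star v ⬝ᵥ (pairField sWave L *ᵥ ψ L) = 0) ∧
              ∀ φ : Fock (Orb (FermionTorus 2 L)), IsGroundStateInSector (hubbardTorus 2 L 1 U) (N L) 0 φ →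
                star (etaLower torusStagger *ᵥ φ) ⬝ᵥ (pairField sWave L *ᵥ ψ L) = 0 := by
  intro U δ hU hδ N ψ hyp
  obtain ⟨C, -, L₀, hIR⟩ := h U δ hU hδ N ψ hyp
  refine ⟨L₀ + 2, fun L _ hE hL => ?_⟩
  have hker : ∀ v : Fock (Orb (FermionTorus 2 L)), v ∈ szSector (Λ := FermionTorus 2 L) (N L - 2) 0 →
      hubbardTorus 2 L 1 U *ᵥ v =
        (((hubbardTorus 2 L 1 U).minEnergyOn (szSector (Λ := FermionTorus 2 L) (N L) 0) - U : ℝ) : ℂ) • v →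
        star v ⬝ᵥ (pairField sWave L *ᵥ ψ L) = 0 :=
    fun v hv hHv => dotProduct_eq_zero_of_irBound_of_zeroMode (hIR L hE (by omega) v hv) hHv
  refine ⟨hker, fun φ hφ => ?_⟩
  have hN2 : 2 ≤ N L := by
    rw [(hyp L hE).1]
    have := one_le_floor_filling (L := L) hδ.2 (by omega)
    omega
  obtain ⟨hmem, hHv⟩ := etaLower_groundState_zeroMode hE U hN2 hφ
  exact hker _ hmem hHv

/-- **The stub is false as soon as a zero mode overlaps `P_s ψ_L` infinitely often** (negative form of
`shiftedInfraredBound_forces_kernel_orthogonality` (i)): if for some `U > 0`, `δ ∈ (0,1/2)` and some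
admissible ground-state sequence, frequently in even `L` a zero mode `v` of `K₋` in the pair-removed sector
has `⟨v, P_s ψ_L⟩ ≠ 0` — possible only on the closed-window branch `E(N_L-2,0) = E(N_L,0) - U`
(`closedWindow_iff_exists_zeroMode`) — then `stub_shiftedInfraredBound` fails for EVERY prefactor.
This is the precise, kernel-checked form of the lead's risk (a) (`Cruxes/NoOnsiteODLRO/PICKED.md`). [folklore] -/
theorem shiftedInfraredBound_false_of_kernelOverlap
    (hex : ∃ (U δ : ℝ), 0 < U ∧ δ ∈ Set.Ioo (0 : ℝ) (1 / 2) ∧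
      ∃ (N : ℕ → ℕ) (ψ : ∀ L, Fock (Orb (FermionTorus 2 L))),
        (∀ L, Even L → N L = 2 * ⌊(1 - δ) * (L : ℝ) ^ 2 / 2⌋₊ ∧ star (ψ L) ⬝ᵥ ψ L = 1 ∧
            IsGroundStateInSector (hubbardTorus 2 L 1 U) (N L) 0 (ψ L)) ∧
          ∀ L₀ : ℕ, ∃ (L : ℕ) (_ : NeZero L), Even L ∧ L₀ ≤ L ∧
            ∃ v ∈ szSector (Λ := FermionTorus 2 L) (N L - 2) 0,
              hubbardTorus 2 L 1 U *ᵥ v =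
                  (((hubbardTorus 2 L 1 U).minEnergyOn (szSector (Λ := FermionTorus 2 L) (N L) 0) - U : ℝ) : ℂ) •
                    v ∧
                star v ⬝ᵥ (pairField sWave L *ᵥ ψ L) ≠ 0) :
    ¬ ∀ (U δ : ℝ), 0 < U → δ ∈ Set.Ioo (0 : ℝ) (1 / 2) →
      ∀ (N : ℕ → ℕ) (ψ : ∀ L, Fock (Orb (FermionTorus 2 L))),
        (∀ L, Even L → N L = 2 * ⌊(1 - δ) * (L : ℝ) ^ 2 / 2⌋₊ ∧ star (ψ L) ⬝ᵥ ψ L = 1 ∧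
            IsGroundStateInSector (hubbardTorus 2 L 1 U) (N L) 0 (ψ L)) →
          ∃ C : ℝ, 0 ≤ C ∧ ∃ L₀ : ℕ, ∀ (L : ℕ) [NeZero L], Even L → L₀ ≤ L →
            ∀ v : Fock (Orb (FermionTorus 2 L)), v ∈ szSector (Λ := FermionTorus 2 L) (N L - 2) 0 →
              ‖star v ⬝ᵥ ((pairField sWave L) *ᵥ (ψ L))‖ ^ 2 ≤
                C * (L : ℝ) ^ 2 *
                  ((expect (hubbardTorus 2 L 1 U) v).re +
                    (U - (hubbardTorus 2 L 1 U).minEnergyOn (szSector (Λ := FermionTorus 2 L) (N L) 0)) *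
                      (star v ⬝ᵥ v).re) := by
  intro h
  obtain ⟨U, δ, hU, hδ, N, ψ, hyp, hfreq⟩ := hex
  obtain ⟨L₀, hL₀⟩ := shiftedInfraredBound_forces_kernel_orthogonality h U δ hU hδ N ψ hyp
  obtain ⟨L, _, hE, hL, v, hv, hHv, hne⟩ := hfreq L₀
  exact hne ((hL₀ L hE hL).1 v hv hHv)

/-- **η-form of the same obstruction**: a ground state `φ` of the sector `(N_L, 0)` with
`⟨η φ, P_s ψ_L⟩ ≠ 0` frequently along an admissible sequence kills the stub (such `φ` needs `η φ ≠ 0`, i.e.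
a ground state that is NOT of lowest pseudospin weight — the closed-window branch again). [folklore] -/
theorem shiftedInfraredBound_false_of_etaOverlap
    (hex : ∃ (U δ : ℝ), 0 < U ∧ δ ∈ Set.Ioo (0 : ℝ) (1 / 2) ∧
      ∃ (N : ℕ → ℕ) (ψ : ∀ L, Fock (Orb (FermionTorus 2 L))),
        (∀ L, Even L → N L = 2 * ⌊(1 - δ) * (L : ℝ) ^ 2 / 2⌋₊ ∧ star (ψ L) ⬝ᵥ ψ L = 1 ∧
            IsGroundStateInSector (hubbardTorus 2 L 1 U) (N L) 0 (ψ L)) ∧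
          ∀ L₀ : ℕ, ∃ (L : ℕ) (_ : NeZero L), Even L ∧ L₀ ≤ L ∧
            ∃ φ : Fock (Orb (FermionTorus 2 L)), IsGroundStateInSector (hubbardTorus 2 L 1 U) (N L) 0 φ ∧
              star (etaLower torusStagger *ᵥ φ) ⬝ᵥ (pairField sWave L *ᵥ ψ L) ≠ 0) :
    ¬ ∀ (U δ : ℝ), 0 < U → δ ∈ Set.Ioo (0 : ℝ) (1 / 2) →
      ∀ (N : ℕ → ℕ) (ψ : ∀ L, Fock (Orb (FermionTorus 2 L))),
        (∀ L, Even L → N L = 2 * ⌊(1 - δ) * (L : ℝ) ^ 2 / 2⌋₊ ∧ star (ψ L) ⬝ᵥ ψ L = 1 ∧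
            IsGroundStateInSector (hubbardTorus 2 L 1 U) (N L) 0 (ψ L)) →
          ∃ C : ℝ, 0 ≤ C ∧ ∃ L₀ : ℕ, ∀ (L : ℕ) [NeZero L], Even L → L₀ ≤ L →
            ∀ v : Fock (Orb (FermionTorus 2 L)), v ∈ szSector (Λ := FermionTorus 2 L) (N L - 2) 0 →
              ‖star v ⬝ᵥ ((pairField sWave L) *ᵥ (ψ L))‖ ^ 2 ≤
                C * (L : ℝ) ^ 2 *
                  ((expect (hubbardTorus 2 L 1 U) v).re +
                    (U - (hubbardTorus 2 L 1 U).minEnergyOn (szSector (Λ := FermionTorus 2 L) (N L) 0)) *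
                      (star v ⬝ᵥ v).re) := by
  intro h
  obtain ⟨U, δ, hU, hδ, N, ψ, hyp, hfreq⟩ := hex
  obtain ⟨L₀, hL₀⟩ := shiftedInfraredBound_forces_kernel_orthogonality h U δ hU hδ N ψ hyp
  obtain ⟨L, _, hE, hL, φ, hφ, hne⟩ := hfreq L₀
  exact hne ((hL₀ L hE hL).2 φ hφ)

end Summit.HubbardSuperconductivity.HubbardSuperconductivity.Theorems.NoOnsiteODLRO.Negative

end
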